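import Mathlib
import HarnessLib
import HarnessLib.Audit
import Summits.Parity.Statement
import Literature.NumberTheory.LFunctions.NoRealZeroUpTo
import Literature.NumberTheory.LFunctions.RealCharacterLadderLeaves
import Literature.NumberTheory.LFunctions.NoRealZeroSmallModuli
import HarnessLib.Audit.Status.Attr

/-!
Route: RealCharacterThetaLadder

DORMANT since 2026-09-01T22:40:22Z (reconciler: no traction for 5 d (last activity item-evidence-added at 2026-08-27T21:50:51Z); parked, not closed — `ledger route dormant route-Parity-RealCharacterThetaLadder --off` to reactivate) — unstaffed, not closed; items shared with open routes are served there. `ledger route dormant <id> --off` reactivates.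

# Route RealCharacterThetaLadder — no real zero for every quadratic primitive χ mod q ≤ 10⁹, by five
certified range × parity blocks

X = "for every modulus 3 ≤ q ≤ 10⁹, every primitive quadratic Dirichlet character χ mod q and every
real σ ∈ (0,1), L(σ,χ) ≠ 0"
= the rung leaf `Literature.NumberTheory.LFunctions.NoRealZeroUpTo_1e9` (D-0061 alt-closer 'closes
rung F-P2 of Parity'; body
`NoRealZeroUpTo 1000000000`). It suffices to show the five range × parity blocks X = R0 ∧ R1odd ∧
R1even ∧ R2odd ∧ R2even:
R0 = q ≤ 4·10⁵ (both parities, Platt's printed range), R1 = 4·10⁵ < q ≤ 10⁸ and R2 = 10⁸ < q ≤ 10⁹,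
each split into odd and even
characters because the printed frontiers (Watkins odd 3·10⁸; Platt/Chua even 4·10⁵/2·10⁵) and the
cell's certifying lineages
(A: Hecke theta; BW: Bernstein panels, even side) differ by parity. This is the D-0059 route OF
RECORD for the DATA rung of cell
parity-realchar: the blocks are decided by certified numerics (two code-disjoint lineages,
referee-signed), not by kernel proof; each
item carries its currency label and closes in the ledger sense only if a kernel replay ever lands.
Lean: `Literature.NumberTheory.LFunctions.NoRealZeroUpTo 1000000000`

## Assembly
Pure logic: range trichotomy q ≤ 4·10⁵ ∨ 4·10⁵ < q ≤ 10⁸ ∨ 10⁸ < q ≤ 10⁹ (`omega`) and Mathlib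
`DirichletCharacter.even_or_odd`;
the deciding theorem `closes` (glue-A.lean, farm rc 0 / 0 sorries) concludes the leaf
`NoRealZeroUpTo_1e9` (= `NoRealZeroUpTo 1000000000`).

CLOSES_TARGET: closes rung F-P2a of Parity: Literature.NumberTheory.LFunctions.NoRealZeroUpTo_1e9 (D-0061; not the summit Statement) — the deciding theorem of this route concludes that registered leaf instead of the Statement decl `GeneralizedHardyLittlewood` (class rung: servable and labelled, never counted as concluding the summit Statement).

Rationale: WHY THIS LINE. Mechanism: a real zero σ ∈ (0,1) of L(s,χ_d) is a zero of the completed function, and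
Λ_d(σ) = ξ(σ,χ_d) is a theta integral whose
positivity on [0,1] is decidable by certified evaluation (lineage A: Taylor models of the Hecke
theta series at 1/2 with a Lagrange
majorant; lineage BW: Chebyshev/Bernstein panel enclosures; tree criterion
`noRealZeroUpTo_iff_dirichletXi_re_pos`, p403290). Print
stops at q ≤ 4·10⁵ for even characters (Platt2016GRH Thms 7.1–7.2; Chua2005RealZeros 2·10⁵) and
3·10⁸ for odd ones
(Watkins2004RealZeros); Languasco 2023 (arXiv:2301.10722, Thm 1) gives only a narrow window for
prime q ≤ 10⁷, and Lu–Zaman–Zhao 2026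
(arXiv:2602.03626) a narrow window σ ≥ 1 − 1/(5 log q) to 10¹⁰. The line imports nothing from
another area: it is certified
computation, and says so; what it does that no prior route does is put the cell's DATA ladder (R0
4·10⁵ two-lineage PASS, R1 10⁸ PASS,
R2 10⁹ running) on the ledger with typed block statements a consumer can take as hypotheses
(`NoRealZeroUpTo.lfunction_one_half_pos`,
`NoRealZeroUpTo.noExceptionalZeroUpTo` ⇒ C1/C2/C2e/C4/C5 of the cell, all proved in the tree and
cited by name, not re-itemised).

RANKED CRUXES. #2 EvenToBillion (crux) — for every modulus 10⁸ < q ≤ 10⁹, every primitive quadratic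
EVEN χ mod q and every σ ∈ (0,1), L(σ,χ) ≠ 0 (2 500× beyond the printed even frontier; DATA lineage
A R2 kit j242929–j242936 running, lineage BW R2-W even j242944 queued; currency: certified
numerics). [difficulty: L] (why it might fail: false iff some even fundamental d ∈ (10⁸,10⁹] has a
real zero; certification fails in practice where Λ_d has a tiny minimum on [0,1] (small L(1/2,χ_d),
low-lying zero) — fixed-precision Taylor models then cannot sign it within budget (≈ 80 core-h).)
[Platt2016GRH, Chua2005RealZeros, arXiv:2602.03626, arXiv:2301.10722]
#3 EvenToHundredMillion (crux) — for every modulus 4·10⁵ < q ≤ 10⁸, every primitive quadratic EVEN χ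
mod q and every σ ∈ (0,1), L(σ,χ) ≠ 0 (250× beyond print; DATA lineage A R1 kit j241631/j241633 PASS
V13, 60 792 709 rows both parities; lineage BW R1-W j242759 DONE 19:01Z, 60 549 538 rows, referee V9
pending; currency: certified numerics, two code-disjoint lineages). [difficulty: M] (why it might
fail: false iff an even d ∈ (4·10⁵,10⁸] has a real zero in (0,1); evidence-side, a value-level join
of the two lineages' enclosures (referee V9) could still find a disjoint pair, sending both
certifiers to audit.) [Platt2016GRH, Chua2005RealZeros, arXiv:2301.10722]
#4 OddToBillion (crux) — for every modulus 10⁸ < q ≤ 10⁹, every primitive quadratic ODD χ mod q and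
every σ ∈ (0,1), L(σ,χ) ≠ 0 (printed to 3·10⁸ by Watkins, single lineage; new for 3·10⁸ < q ≤ 10⁹;
DATA lineage A R2 running; BW odd R2-W unfunded; currency: certified numerics). [difficulty: L] (why
it might fail: false iff an odd d with 10⁸ < |d| ≤ 10⁹ has a real zero; odd Λ_d(1/2) is smallest for
d with many small split primes (class-number-one-like d), where certification needs deeper Taylor
order than budgeted.) [Watkins2004RealZeros, Platt2016GRH, arXiv:2602.03626]
#9 PlattRange (support) — no real zero in (0,1) for every primitive quadratic χ mod 3 ≤ q ≤ 4·10⁵,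
both parities — Platt's printed range (tree `noRealZeroUpTo_platt` modulo the named facts
`platt2016_theorem71/72`) and the cell's STEP-0: two code-disjoint certified lineages A (j241268)
and BW (j242447), 243 171/243 171 fundamental d, referee-signed STEP0-PASS / STEP0-W-PASS; kernel
sub-ranges `noRealZeroUpTo_twentyThree` (p403994), `noRealZeroOddUpTo_144`, Fekete–Pólya/Chowla
files are its registered skeleton stubs. [difficulty: XL] [Platt2016GRH, Watkins2004RealZeros,
Chua2005RealZeros]
#9 OddToHundredMillion (support) — for every modulus 4·10⁵ < q ≤ 10⁸, every primitive quadratic ODD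
χ mod q and every σ ∈ (0,1), L(σ,χ) ≠ 0 — inside Watkins' printed theorem (`watkins2004_theorem` +
`NoRealZeroOddUpTo.anti_level`, named fact) and reproduced by DATA lineage A R1 (PASS V13).
[difficulty: XL] [Watkins2004RealZeros]

TWO-LAYER PLAN. If R2 stalls or fails its referee criteria (V8), the route is re-pointed at the
fallback leaf `NoRealZeroUpTo_1e8` by dropping the two
R2 blocks (glue unchanged otherwise). Foreseen split of PlattRange only if a kernel replay is
attempted: PlattRange ⇐ (q ≤ 23 kernel,
`noRealZeroUpTo_twentyThree`) → (odd 23 < q ≤ 144 kernel, Epstein class sums) → (the certified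
remainder); nothing filed now.

KILL CRITERIA. A certified real zero (an interval on which Λ_d < 0 with d ≤ 10⁹, reproduced by the
second lineage) refutes the block containing d and
closes the route `refuted:<Block>` — and is a theorem of independent interest (a counterexample to
Chowla's no-real-zero conjecture).
A referee GAP verdict on lineage A's R1/R2 (V7/V8) that is not repaired within the cell's budget
forces the pivot to the `_1e8` /
`_4e5` leaf. A kernel proof of GRH-type statements for these q would moot it (not expected).

NOT DECOMPOSED YET. No per-discriminant or per-batch items (3 320 batches at R0, ~10⁴ at R2):
batches are engine bookkeeping in HOME/DATA.md, not ledger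
items. No item for the ξ-positivity form of each block (equivalent by
`noRealZeroUpTo_iff_dirichletXi_re_pos`); no consumer items
(C1/C2/C2e/C4/C5, central values: proved in the tree, cited by name). Kernel replay of wide rows
beyond |d| ≈ 200 is not planned
(per-(d,n) incomplete-gamma enclosures do not share tables; infeasible in the kernel at 10⁵ rows).

CHEAPEST FALSIFIER. Re-run lineage BW (code-disjoint, integer-only) on a random 10⁴-discriminant
window inside (10⁸,10⁹] for even d and join enclosures
with lineage A's: one disjoint pair of enclosures kills the block's evidence (not the statement) and
sends both lineages to audit.
Already run at R0: referee's full value-level join A vs BW over all 243 171 rows, 0 disjoint, worst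
separation 0.0244 at d = −907.

NUMBERS. Printed wide frontier: even q ≤ 4·10⁵ (Platt2016GRH Thms 7.1–7.2), 2·10⁵ (Chua2005RealZeros
Thm 1.1); odd d ≤ 3·10⁸
(Watkins2004RealZeros, Theorem p. 416). Narrow: σ ≥ 1 − 1/(5 log q), all quadratic χ, q ≤ 10¹⁰
(arXiv:2602.03626 Thm 1.1,
150k core-h); prime q ≤ 10⁷, β < 1 − c₂/log q (arXiv:2301.10722 Thm 1, non-certified floating
point). Cell: R0 243 171 d two-lineage;
R1 60 792 709 rows, 13.6 core-h lineage A; R2 ≈ 80 core-h lineage A (authorised ≤ 100), BW even ≈ 30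
core-h; Möbius counts
N±(10⁹) = 303 963 559 / 303 963 510 fundamental discriminants.

DEFINITION REQUESTS. None. The rung leaf `Literature.NumberTheory.LFunctions.NoRealZeroUpTo_1e9 :
Prop := NoRealZeroUpTo 1000000000` (closed instance)
is landed by the cell's rc-prover (INBOX 2026-08-25T18:58:04Z); until then `closes` concludes the
body.

Novelty: Searches (2026-08-25): lit search --hybrid "real zeros of quadratic Dirichlet L-functions verified
computation discriminant" (8 docs: Montgomery–Vaughan 2007 p.109, Cohen 1993, Buell 1989 —
textbooks, no table); lit search "Landau-Siegel zeros numerical computations" --source all (local 6: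
arXiv:2602.03626 pp.1,16,20; arXiv:2301.10722 p.9; remote zbMATH/Crossref 4:
doi:10.1016/j.jnt.2023.04.008, doi:10.1090/mcom/4268, Sarnak–Zaharescu 2002); lit galaxy search
"real zeros of real|Landau-Siegel zero|no Siegel zero" --star all (21 rows, none a verification
table; pdf:199087960 Stopple 'Repulsive behavior in an exceptional family' = context); lit read
arxiv:2301.10722 --grep (p.3: "Watkins … q ≤ 3·10⁸ odd, Platt … even q ≤ 4·10⁵; our Theorem
meaningful only for 4·10⁵ < q ≤ 10⁷, q prime, χ even").
Nearest prior art found: Platt2016GRH (Math. Comp. 85, Thms 7.1–7.2: even and odd, q ≤ 4·10⁵, via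
GRH to height 10⁸/q) [corpus: tree NoRealZeroUpTo.lean cite]; Watkins2004RealZeros (odd, 3·10⁸,
Low's criterion) ; Chua2005RealZeros (even, 2·10⁵); arXiv:2301.10722 Thm 1 [corpus:arxiv-2301.10722
p.3] (prime q ≤ 10⁷, narrow, non-certified); arXiv:2602.03626 Thm 1.1 [corpus:arxiv-2602.03626 p.1]
(narrow, 10¹⁰).
Delta: the even wide column moves from 4·10⁵ (print) to 10⁹ with two code-disjoint certified
lineages, and the statements are typed so that the tree's consumers take them as hypotheses; no new
mathematics is claimed.
Claimed grade: variant  [refs: 10.1016/j.jnt.2023.04.008, 10.1090/mcom/4268, 2602.03626, 2301.10722, doi:10.1016/j.jnt.2023.04.008, doi:10.1090/mcom/4268, arxiv:2301.10722, arxiv-2301.10722, arxiv-2602.03626]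

Barriers (technique_class: certified-numerics, theta-positivity, interval-arithmetic): - technique_class: certified-numerics, theta-positivity, interval-arithmetic
- Literature.Barriers.Parity.SiegelZeroTwinPrimes: it does not touch it and does not try — a finite
table (q ≤ 10⁹) implies nothing about Siegel zeros of unbounded quality or about twin primes (H4/H5
of the cell); the route is an instrument (explicit constants for q ≤ Q), not a summit move.
- Literature.Barriers.Parity.SiegelZeroPrimePairBarrier: outside its class — no shift-uniform
prime-pair bound is claimed or used; the only output is L(σ,χ_d) ≠ 0 on (0,1) for |d| ≤ 10⁹, which
the barrier neither forbids nor is fed by.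
- Literature.Barriers.Parity.BrunTitchmarshSiegelZero: not in its class (no sieve bound is improved;
nothing asymptotic is claimed). (Uncatalogued for Parity but relevant: the RH-side Epstein/class-sum
kernel method, `Literature/Barriers/RiemannHypothesis/EpsteinZetaRealZerosSmallK.lean`, is blocked
from d ≥ 200 by its own scope statement — which is why the currency above |d| = 144 is certified
numerics, not kernel.)
- Negatives index: empty for these statements at filing (no refuted `NoRealZero*` /
`NoExceptionalZero*` instance; the A1 episode — `NoExceptionalZeroUpTo` without `0 < σ` is false via
L(−1,χ₃) = 0 — is built into the landed definitions).

History (route lifecycle, newest last):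
- 2026-08-25T23:07:08Z · closes_target -> closes rung F-P2a of Parity: Literature.NumberTheory.LFunctions.NoRealZeroUpTo_1e9 (D-0061; not the summit Statement) (planner-parity-realchar-theory-g3-0)
- 2026-08-26T09:57:57Z · rev 5: informal re-worded for EvenToHundredMillion (planner-parity-realchar-theory-g6-0)
- 2026-08-26T10:15:03Z · rev 6: informal re-worded for EvenToBillion (planner-parity-realchar-theory-g6-0)
- 2026-08-26T10:15:11Z · rev 7: informal re-worded for OddToBillion (planner-parity-realchar-theory-g6-0)
- 2026-08-26T10:15:25Z · rev 8: informal re-worded for PlattRange (planner-parity-realchar-theory-g6-0)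
- 2026-08-26T10:15:45Z · rev 9: informal re-worded for OddToHundredMillion (planner-parity-realchar-theory-g6-0)
- 2026-09-01T22:40:22Z · DORMANT — reconciler: no traction for 5 d (last activity item-evidence-added at 2026-08-27T21:50:51Z); parked, not closed — `ledger route dormant route-Parity-RealCharact (operator:999:266775)

sub-problem: GeneralizedHardyLittlewood · status: dormant · opened planner-parity-realchar-theory-g3-0 2026-08-25T19:16:14Z · rev 9 · ledger route-Parity-RealCharacterThetaLadder
GENERATED by the gate from the ledger (D-0016/17). Provers cite these decls: `theorem foo : Summit.Parity.GeneralizedHardyLittlewood.Theses.RealCharacterThetaLadder.<Decl> := …` in Summits/Parity/GeneralizedHardyLittlewood/Theorems/<Name>.lean.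
-/

namespace Summit.Parity.GeneralizedHardyLittlewood.Theses.RealCharacterThetaLadder

open scoped BigOperators Topology Manifold Classical MeasureTheory ProbabilityTheory Matrix InnerProductSpace ComplexConjugate ContinuousMap
open Filter Set Function TopologicalSpace MeasureTheory

attribute [summit_statement] _root_.GeneralizedHardyLittlewood
attribute [summit_statement] _root_.Literature.NumberTheory.LFunctions.NoRealZeroUpTo_1e9

/-- item stmt-Parity-18821 · crux · rank 2 · open · by planner
why it might fail: false iff some even fundamental d ∈ (10⁸,10⁹] has a real zero; certification fails in practice where Λ_d has a tiny minimum on [0,1] (small L(1/2,χ_d), low-lying zero) — fixed-precision Taylor models then cannot sign it within budget (≈ 80 core-h).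
sources: Platt2016GRH, Chua2005RealZeros, arXiv:2602.03626, arXiv:2301.10722
for every modulus 10⁸ < q ≤ 10⁹, every primitive quadratic EVEN χ mod q and every σ ∈ (0,1), L(σ,χ)
≠ 0 (2 500× beyond the printed even range). BOOKED in the route's currency (certified numerics, two
code-disjoint referee-signed lineages; text refreshed 2026-08-26 per tribunal №10 (4), statement
unchanged): lineage A regime 2 v2e (kit j242929/j242932/j242934/j242936 + R0/R1; referee V34 PASS
«all 607 927 069 primitive quadratic characters of conductor ≤ 10⁹ (303 963 559 even + 303 963 510
odd) certified free of real zeros in (0,1)») ∧ lineage BW R2-W even (six jobs + cross-check, 18 938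
windows tiling [10⁸+1, 10⁹+1) exactly; referee V32 PASS; V32-A two-sided BW enclosure at the even
argmin d = 402 791 045, L(½) ∈ [3.208, 3.291]·10⁻⁶ ∋ A's 3.2494·10⁻⁶). Closing bundle attached to
stmt-Parity-18821; the item stays OPEN+BOOKED (D1–D3) and closes in the ledger sense only on a
kernel replay. -/
@[route_item "route-Parity-RealCharacterThetaLadder", crux]
def EvenToBillion : Prop :=
  ∀ (q : ℕ) [NeZero q], 100000000 < q → q ≤ 1000000000 → ∀ χ : DirichletCharacter ℂ q, χ.IsQuadratic → χ.IsPrimitive → χ.Even → ∀ σ : ℝ, 0 < σ → σ < 1 → χ.LFunction σ ≠ 0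

/-- item stmt-Parity-18822 · crux · rank 3 · open · by planner
why it might fail: false iff an even d ∈ (4·10⁵,10⁸] has a real zero in (0,1); evidence-side, a value-level join of the two lineages' enclosures (referee V9) could still find a disjoint pair, sending both certifiers to audit.
sources: Platt2016GRH, Chua2005RealZeros, arXiv:2301.10722
for every modulus 4·10⁵ < q ≤ 10⁸, every primitive quadratic EVEN χ mod q and every σ ∈ (0,1),
L(σ,χ) ≠ 0 (250× beyond the printed even range). BOOKED in the route's currency (certified numerics,
two code-disjoint referee-signed lineages; text refreshed 2026-08-26 per tribunal №10 (4), statement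
unchanged): lineage A regime 1 (certify.py; kit j241631/j241633; referee V13 PASS; 60 792 709 rows
both parities) ∧ lineage BW R1-W (bwcert; j242759; 60 549 538 even rows; referee V18 PASSED —
supersedes the earlier «V9 pending» wording). Closing bundle (consolidated BOOKED record) attached
to stmt-Parity-18822; the item stays OPEN+BOOKED (director D1–D3) and closes in the ledger sense
only if a kernel replay lands. -/
@[route_item "route-Parity-RealCharacterThetaLadder", crux]
def EvenToHundredMillion : Prop :=
  ∀ (q : ℕ) [NeZero q], 400000 < q → q ≤ 100000000 → ∀ χ : DirichletCharacter ℂ q, χ.IsQuadratic → χ.IsPrimitive → χ.Even → ∀ σ : ℝ, 0 < σ → σ < 1 → χ.LFunction σ ≠ 0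

/-- item stmt-Parity-18823 · crux · rank 4 · open · by planner
why it might fail: false iff an odd d with 10⁸ < |d| ≤ 10⁹ has a real zero; odd Λ_d(1/2) is smallest for d with many small split primes (class-number-one-like d), where certification needs deeper Taylor order than budgeted.
sources: Watkins2004RealZeros, Platt2016GRH, arXiv:2602.03626
for every modulus 10⁸ < q ≤ 10⁹, every primitive quadratic ODD χ mod q and every σ ∈ (0,1), L(σ,χ) ≠
0 (printed to 3·10⁸ by Watkins, single lineage; new for 3·10⁸ < q ≤ 10⁹). BOOKED in the route's
currency (certified numerics, two code-disjoint referee-signed lineages; text refreshed 2026-08-26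
per tribunal №10 (4), statement unchanged): lineage A regime 2 (referee V34 PASS) ∧ lineage BW R2-W
odd (kit j244998/j245000/j245001/j245003; referee V35 PASSED — supersedes the earlier «BW odd R2-W
unfunded» wording; odd record rows with two-sided BW positivity, V32-A). Closing bundle attached to
stmt-Parity-18823; the item stays OPEN+BOOKED (D1–D3) and closes in the ledger sense only on a
kernel replay. -/
@[route_item "route-Parity-RealCharacterThetaLadder", crux]
def OddToBillion : Prop :=
  ∀ (q : ℕ) [NeZero q], 100000000 < q → q ≤ 1000000000 → ∀ χ : DirichletCharacter ℂ q, χ.IsQuadratic → χ.IsPrimitive → χ.Odd → ∀ σ : ℝ, 0 < σ → σ < 1 → χ.LFunction σ ≠ 0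

/-- item stmt-Parity-18824 · support · rank 9 · open · by planner
sources: Platt2016GRH, Watkins2004RealZeros, Chua2005RealZeros
no real zero in (0,1) for every primitive quadratic χ mod 3 ≤ q ≤ 4·10⁵, both parities — Platt's
printed range. RESIDUAL of the route (tribunal №10: tier B on the leaf modulo [PlattRange,
OddToHundredMillion]); CLOSING CURRENCY stated for consumers of NoRealZeroUpTo_1e9 (text refreshed
2026-08-26 per №10 (3), statement unchanged): (i) PRINT, conditional in the kernel — tree
`noRealZeroUpTo_platt` modulo the NAMED FACTS `platt2016_theorem71` / `platt2016_theorem72` (Platt,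
Math. Comp. 85 (2016) Thms 7.1/7.2: GRH to height 10⁸/q for primitive χ, q ≤ 4·10⁵ ⇒ no real zero);
(ii) CERTIFIED NUMERICS — the cell's STEP-0: two code-disjoint integer-certified lineages A
(certify.py, kit j241268) and BW (bwcert, j242447) over all 243 171 fundamental d with 3 ≤ |d| ≤
4·10⁵, referee-signed STEP0-PASS / STEP0-W-PASS with a full value-level join (0 disjoint, worst
separation 0.0244 at d = −907), and lineage C's in-job STEP-0 guards (V59/V68); (iii) KERNEL,
unconditional, sub-ranges only — `noRealZeroUpTo_twentyThree` (q ≤ 23, p403994),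
`noRealZeroOddUpTo_144` (odd q ≤ 144, Epstein class sums), the Fekete–Pólya / Chowla files
(registered skeleton stubs in the decade routes). So a consumer reads: « -/
@[route_item "route-Parity-RealCharacterThetaLadder", crux]
def PlattRange : Prop :=
  Literature.NumberTheory.LFunctions.NoRealZeroUpTo 400000

/-- item stmt-Parity-18825 · support · rank 9 · open · by planner
sources: Watkins2004RealZeros
for every modulus 4·10⁵ < q ≤ 10⁸, every primitive quadratic ODD χ mod q and every σ ∈ (0,1), L(σ,χ)
≠ 0 — inside Watkins' printed theorem. RESIDUAL of the route (tribunal №10); CLOSING CURRENCY stated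
for consumers (text refreshed 2026-08-26 per №10 (3), statement unchanged): (i) PRINT, conditional
in the kernel — the NAMED FACT `watkins2004_theorem` (Watkins, Math. Comp. 73 (2004) 415–423: no
real zero σ > 0 for odd real primitive χ_d, |d| ≤ 3·10⁸) + the PROVED monotonicity
`NoRealZeroOddUpTo.anti_level`; (ii) CERTIFIED NUMERICS — reproduced by lineage A regime 1 (kit
j241631/j241633, referee V13 PASS: the odd half of the 60 792 709-row R1 campaign), ONE certified
lineage (the cell bought no second lineage inside print for odd R1; BW R1-W covered the even side).
So a consumer reads: «modulo watkins2004_theorem (print) — reproduced once by certified numerics (A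
R1, V13)». -/
@[route_item "route-Parity-RealCharacterThetaLadder", crux]
def OddToHundredMillion : Prop :=
  ∀ (q : ℕ) [NeZero q], 400000 < q → q ≤ 100000000 → ∀ χ : DirichletCharacter ℂ q, χ.IsQuadratic → χ.IsPrimitive → χ.Odd → ∀ σ : ℝ, 0 < σ → σ < 1 → χ.LFunction σ ≠ 0

/-- item stmt-Parity-18826 · assembly · rank 1 · closed · proved by Summit.Parity.GeneralizedHardyLittlewood.Theorems.realCharacterThetaLadder_assembly_proof @ 2ec3f7057781 (prover) · by planner
sources: Platt2016GRH
[assembly] PlattRange → OddToHundredMillion → EvenToHundredMillion → OddToBillion → EvenToBillion →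
no real zero up to 10⁹. -/
@[route_item "route-Parity-RealCharacterThetaLadder"]
def Assembly : Prop :=
  PlattRange → OddToHundredMillion → EvenToHundredMillion → OddToBillion → EvenToBillion → Literature.NumberTheory.LFunctions.NoRealZeroUpTo 1000000000

-- `Assembly` holds: proved by `Summit.Parity.GeneralizedHardyLittlewood.Theorems.realCharacterThetaLadder_assembly_proof` @ 2ec3f7057781 (its module imports this route file, so no `_holds` link can be stated here).

/-! D-0027 §2.1 — DECIDING THEOREM (planner-authored via `route open/edit --closes-file`; by planner-parity-realchar-theory-g3-0 2026-08-25T23:07:08Z):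
its hypotheses are this route's items and its conclusion the registered leaf `Literature.NumberTheory.LFunctions.NoRealZeroUpTo_1e9` (rung F-P2a, D-0061) (glue_lint), and it elaborates with this file. -/

@[closes "route-Parity-RealCharacterThetaLadder"] theorem closes (h0 : PlattRange) (h1o : OddToHundredMillion) (h1e : EvenToHundredMillion)
    (h2o : OddToBillion) (h2e : EvenToBillion) :
    Literature.NumberTheory.LFunctions.NoRealZeroUpTo_1e9 := by
  show Literature.NumberTheory.LFunctions.NoRealZeroUpTo 1000000000
  intro q _ hq3 hqQ χ hquad hprim σ hσ0 hσ1
  by_cases hq0 : q ≤ 400000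
  · exact h0 q hq3 hq0 χ hquad hprim σ hσ0 hσ1
  · by_cases hq1 : q ≤ 100000000
    · rcases χ.even_or_odd with hev | hod
      · exact h1e q (by omega) hq1 χ hquad hprim hev σ hσ0 hσ1
      · exact h1o q (by omega) hq1 χ hquad hprim hod σ hσ0 hσ1
    · rcases χ.even_or_odd with hev | hod
      · exact h2e q (by omega) hqQ χ hquad hprim hev σ hσ0 hσ1
      · exact h2o q (by omega) hqQ χ hquad hprim hod σ hσ0 hσ1

end Summit.Parity.GeneralizedHardyLittlewood.Theses.RealCharacterThetaLadder
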